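import Summits.QuantumAdvantage.QuantumAdvantage.Theorems.LinnikCubicClassGroupsDegreeOnePrimesEscapeClassPNTFamilyZeroSumZFR
import Summits.QuantumAdvantage.QuantumAdvantage.Theorems.LinnikCubicClassGroupsDegreeOnePrimesEscapeClassPNTSmoothedMain
import Literature.NumberTheory.LFunctions.UniformClassGroupPNTReduction
import HarnessLib

/-!
# The class prime number theorem with DECAYING error, II: the core estimate for the smoothed class sums

Topic `Summits/QuantumAdvantage/QuantumAdvantage/Theorems`, cell B2b-1 (linnik-cubic), PART A (gen 32);
helper toward the crux `DegreeOnePrimesEscape` (stmt-QuantumAdvantage-11543) of route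
`LinnikCubicClassGroups`.  HONEST FRAMING: the value of this file is a THEOREM (kernel-checked,
GRH-free) — NOT summit progress (the route still rests on the hypothesis-type target
`PureCubicClassNumberHard`).

`smoothedClassSum_decay_core` isolates the estimate `hcore` inside the proof of
`smoothedClassSum_dichotomy_dh` (`…ClassPNTDHSmoothed.lean`) as a theorem with the zero-free constant `c_Z`
off the exceptional segment as a PARAMETER and WITHOUT any target accuracy: for a number field `K` of degree
`n` obeying the family density bound in `Q`-form, `x ≥ Q^{a_C}`, `g_x = tzTest (log x) x^{−ν}`, a class `C`,
finite sets `Exc ψ` of non-trivial zeros containing all zeros on `excRegion c K`, and `c_Z > 0` such that every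
zero off the segment with `1/4 ≤ β < 1`, `|γ| ≤ x` has `β ≤ 1 − c_Z/(a log Q + log(|γ| + 4))`:

  `‖h ψ̃_C(g_x) − F(−1) + Σ_ψ ψ(C⁻¹) Σ_{ρ ∈ Exc ψ} m_ψ(ρ) F(−ρ)‖
      ≤ x · A₀ (e^{−c_Z L/(4a log Q)} + e^{−√(c_Z L/4)}) + A_J x^{1−ν}`,     `L = log x`,

with `ν, a_C, A₀, A_J` depending on `n, b, D, a` only (`fam_zeroSum_le_local_zfr` for the zeros off the
segment, `norm_classNumber_mul_smoothedPsiClass_sub_le` for the explicit formula of the family, the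
trivial-zero and left-line bounds `famMult_zero_term_le`, `leftLine_term_le(_one)`, and `h_K ≤ Q⁴ ≤ x^{1/8}`).
It is the common first step of the `η`-form (gen 4) and of the decaying form (gen 32,
`…ClassPNTDHSmoothedDecay.lean`) of [ThornerZaman2019, Thm. 1.4 / §5].
References: J. Thorner, A. Zaman, Algebra Number Theory 13 (2019), §4–5 [ThornerZaman2019];
J. C. Lagarias, H. L. Montgomery, A. M. Odlyzko, Invent. Math. 54 (1979), §7 [LagariasMontgomeryOdlyzko1979].
-/

noncomputable section

open Complex Real MeasureTheory Set Filter Topology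
open scoped NumberField nonZeroDivisors

namespace Summit.QuantumAdvantage.QuantumAdvantage.Theorems.DegreeOnePrimesEscape

open Literature.NumberTheory.LFunctions Literature.NumberTheory.LFunctions.NumberField
  Literature.NumberTheory.LFunctions.EntireEF Literature.NumberTheory.LFunctions.TZWeight
  Literature.NumberTheory.LFunctions.AbelianDensity

/-- **The junk terms are `O(x^{1−ν})`**: for `Q ≥ 12`, `x ≥ Q^{a₁}` (`a₁ ≥ 32`), `0 < ν ≤ 1/64`, `h ≤ Q⁴`:
`A₀ x^{1−ν} + h (1152 e^{(log x)/4} + C_J) ≤ (A₀ + 1152 + C_J) x^{1−ν}` (`h ≤ Q⁴ ≤ x^{1/8}`). [folklore] -/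
theorem junk_le_rpow {A₀ CJ h Q x ν a₁ : ℝ} (hCJ : 0 ≤ CJ) (hQ : 12 ≤ Q)
    (hh : h ≤ Q ^ 4) (hν : 0 < ν) (hν1 : ν ≤ 1 / 64) (hx : Q ^ a₁ ≤ x) (ha₁ : 32 ≤ a₁) :
    A₀ * x ^ (1 - ν) + h * (1152 * Real.exp (Real.log x / 4) + CJ) ≤ (A₀ + 1152 + CJ) * x ^ (1 - ν) := by
  have hQ0 : 0 < Q := by linarith
  have hQ1 : (1 : ℝ) ≤ Q := by linarith
  have hxQ : Q ≤ x := by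
    have := Real.rpow_le_rpow_of_exponent_le hQ1 (by linarith : (1 : ℝ) ≤ a₁)
    rw [Real.rpow_one] at this; exact this.trans hx
  have hx1 : (1 : ℝ) ≤ x := by linarith
  have hx0 : 0 < x := by linarith
  have hQ4 : Q ^ 4 ≤ x ^ ((1 : ℝ) / 8) := by
    have h1 : (Q ^ (4 : ℕ) : ℝ) = (Q ^ a₁) ^ ((4 : ℝ) / a₁) := by
      rw [← Real.rpow_mul hQ0.le, mul_div_cancel₀ _ (by linarith : a₁ ≠ 0)]
      norm_cast
    rw [h1]
    calc (Q ^ a₁) ^ ((4 : ℝ) / a₁) ≤ x ^ ((4 : ℝ) / a₁) :=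
          Real.rpow_le_rpow (Real.rpow_nonneg hQ0.le _) hx (by positivity)
      _ ≤ x ^ ((1 : ℝ) / 8) := by
          refine Real.rpow_le_rpow_of_exponent_le hx1 ?_
          rw [div_le_iff₀ (by linarith)]; linarith
  have hh' : h ≤ x ^ ((1 : ℝ) / 8) := hh.trans hQ4
  have hexp : Real.exp (Real.log x / 4) = x ^ ((1 : ℝ) / 4) := by
    rw [Real.rpow_def_of_pos hx0]; ring_nf
  have hpow1 : x ^ ((1 : ℝ) / 8) * x ^ ((1 : ℝ) / 4) ≤ x ^ (1 - ν) := by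
    rw [← Real.rpow_add hx0]
    exact Real.rpow_le_rpow_of_exponent_le hx1 (by linarith)
  have hpow2 : x ^ ((1 : ℝ) / 8) ≤ x ^ (1 - ν) := Real.rpow_le_rpow_of_exponent_le hx1 (by linarith)
  have hJ1 : h * (1152 * Real.exp (Real.log x / 4)) ≤ 1152 * x ^ (1 - ν) := by
    rw [hexp]
    calc h * (1152 * x ^ ((1 : ℝ) / 4)) ≤ x ^ ((1 : ℝ) / 8) * (1152 * x ^ ((1 : ℝ) / 4)) :=
          mul_le_mul_of_nonneg_right hh' (by positivity)
      _ = 1152 * (x ^ ((1 : ℝ) / 8) * x ^ ((1 : ℝ) / 4)) := by ring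
      _ ≤ 1152 * x ^ (1 - ν) := mul_le_mul_of_nonneg_left hpow1 (by norm_num)
  have hJ2 : h * CJ ≤ CJ * x ^ (1 - ν) := by
    calc h * CJ ≤ x ^ ((1 : ℝ) / 8) * CJ := mul_le_mul_of_nonneg_right hh' hCJ
      _ = CJ * x ^ ((1 : ℝ) / 8) := mul_comm _ _
      _ ≤ CJ * x ^ (1 - ν) := mul_le_mul_of_nonneg_left hpow2 hCJ
  rw [mul_add h]; nlinarith [hJ1, hJ2]

set_option maxHeartbeats 1600000 in
/-- **The core estimate for the smoothed class sums of the family, zero-free constant as a parameter**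
(see the module docstring). [cite: ThornerZaman2019, §4–5] [cite: LagariasMontgomeryOdlyzko1979, §7] -/
theorem smoothedClassSum_decay_core (n : ℕ) (hn : 1 < n) {b D a : ℝ} (hb : 0 < b) (hD : 0 < D)
    (ha : 1 ≤ a) :
    ∃ ν aC A₀ AJ : ℝ, 0 < ν ∧ ν ≤ 1 / 64 ∧ 32 ≤ aC ∧ 0 < A₀ ∧ 0 < AJ ∧
    ∀ (K : Type) [Field K] [NumberField K], Module.finrank ℚ K = n →
      (∀ (T : ℝ), 1 ≤ T → ∀ u : AddChar (Additive (ClassGroup (𝓞 K))) ℂ → Finset ℂ,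
        (∀ ψ, ∀ ρ ∈ u ψ, famF K ψ ρ = 0 ∧ 1 / 4 ≤ ρ.re ∧ ρ.re < 1 ∧ |ρ.im| ≤ T) →
        ∀ α : ℝ, α ≤ 1 →
          ∑ ψ, ∑ ρ ∈ u ψ with α ≤ ρ.re, (famMult K ψ ρ : ℝ) ≤
            D * Real.exp (b * (a * Real.log (ThornerZaman.condQn K) + Real.log (T + 4))) ^ (1 - α)) →
      ∀ (c : ℝ) (x : ℝ), ThornerZaman.condQn K ^ aC ≤ x →
      ∀ (Cl : ClassGroup (𝓞 K)) (Exc : AddChar (Additive (ClassGroup (𝓞 K))) ℂ → Finset ℂ),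
      (∀ ψ, ∀ ρ ∈ Exc ψ, famF K ψ ρ = 0 ∧ 0 < ρ.re ∧ ρ.re < 1) →
      (∀ ψ ρ, famF K ψ ρ = 0 → 0 < ρ.re → ρ.re < 1 → excRegion c K ρ → ρ ∈ Exc ψ) →
      ∀ cZ : ℝ, 0 < cZ →
      (∀ (ψ : AddChar (Additive (ClassGroup (𝓞 K))) ℂ) (ρ : ℂ), famF K ψ ρ = 0 → 1 / 4 ≤ ρ.re →
        ρ.re < 1 → |ρ.im| ≤ x → ¬ excRegion c K ρ →
          ρ.re ≤ 1 - cZ / (a * Real.log (ThornerZaman.condQn K) + Real.log (|ρ.im| + 4))) →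
      ‖(NumberField.classNumber K : ℂ) * (smoothedPsiClass K Cl (tzTest (Real.log x) (x ^ (-ν))) : ℂ) -
          fordLaplace (tzTest (Real.log x) (x ^ (-ν))) (-1) +
          ∑ ψ : AddChar (Additive (ClassGroup (𝓞 K))) ℂ, ψ (Additive.ofMul Cl⁻¹) *
            ∑ ρ ∈ Exc ψ, (famMult K ψ ρ : ℂ) * fordLaplace (tzTest (Real.log x) (x ^ (-ν))) (-ρ)‖ ≤
        x * (A₀ * (Real.exp (-(cZ * Real.log x / (4 * a * Real.log (ThornerZaman.condQn K)))) +
          Real.exp (-Real.sqrt (cZ * Real.log x / 4)))) + AJ * x ^ (1 - ν) := by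
  classical
  obtain ⟨ν, a₀, A₀, hν0, hν64, ha₀1, hA₀, hZ⟩ := fam_zeroSum_le_local_zfr n hn hb hD ha
  obtain ⟨Al, hAl0, hAl⟩ := exists_norm_logDeriv_classGroupLFunction_left_le
  obtain ⟨M, hM1, hM⟩ := TZWeight.exists_smoothTransition_deriv_bound
  have hlC := leftLineConst_nonneg
  set CJ : ℝ := 8 * leftLineConst * Al * ((n : ℝ) + 1) * M with hCJ
  have hM0 : 0 ≤ M := by linarith
  have hCJ0 : 0 ≤ CJ := by positivity
  set AJ : ℝ := A₀ + 1152 + CJ with hAJ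
  have hAJ0 : 0 < AJ := by rw [hAJ]; positivity
  set aC : ℝ := max a₀ 32 with haC
  have haCa₀ : a₀ ≤ aC := le_max_left _ _
  have haC32 : (32 : ℝ) ≤ aC := le_max_right _ _
  have haC1 : (1 : ℝ) ≤ aC := by linarith
  refine ⟨ν, aC, A₀, AJ, hν0, hν64, haC32, hA₀, hAJ0, fun K _ _ hKn hdens c x hx Cl Exc hExc hExc' cZ hcZ hzfr ↦ ?_⟩
  have hK : 1 < Module.finrank ℚ K := by rw [hKn]; exact hn
  set Q : ℝ := ThornerZaman.condQn K with hQ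
  have hQ12 : (12 : ℝ) ≤ Q := ThornerZaman.twelve_le_condQn (K := K) hK
  have hQ1 : (1 : ℝ) < Q := by linarith
  have hQ0 : (0 : ℝ) < Q := by linarith
  have hlogQ : 2 ≤ Real.log Q := two_lt_log_twelve.le.trans (Real.log_le_log (by norm_num) hQ12)
  have hhQ : (NumberField.classNumber K : ℝ) ≤ Q ^ 4 := by
    have := ThornerZaman.classNumber_le_condQn_pow (K := K) hK; rw [← hQ] at this; exact this
  have hxa₀ : Q ^ a₀ ≤ x := le_trans (Real.rpow_le_rpow_of_exponent_le hQ1.le haCa₀) hx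
  have hxQ : Q ≤ x := by
    have : Q ^ (1 : ℝ) ≤ Q ^ aC := Real.rpow_le_rpow_of_exponent_le hQ1.le haC1
    rw [Real.rpow_one] at this; linarith
  have hx1 : 1 < x := by linarith
  have hx0 : 0 < x := by linarith
  set L : ℝ := Real.log x with hL
  have hLQ : aC * Real.log Q ≤ L := by
    have := Real.log_le_log (by positivity) hx
    rwa [Real.log_rpow (by linarith)] at this
  have hL2a : 2 * aC ≤ L := by nlinarith
  have hL64 : 64 ≤ L := by nlinarith
  have hL0 : 0 < L := by linarith
  have hQexp : Q ≤ Real.exp (L / 8) := by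
    refine le_exp_of_log_le (by linarith) ?_
    rw [le_div_iff₀ (by norm_num)]; nlinarith
  set ε : ℝ := x ^ (-ν) with hε
  have hε0 : 0 < ε := Real.rpow_pos_of_pos hx0 _
  have hε1 : ε ≤ 1 := Real.rpow_le_one_of_one_le_of_nonpos hx1.le (by linarith)
  have hεL : ε < L / 2 := by linarith
  have hεexp : ε = Real.exp (-(ν * L)) := by
    rw [hε, Real.rpow_def_of_pos hx0, ← hL]; ring_nf
  have hBf := hZ c K hKn hdens x hxa₀ cZ hcZ hzfr ε le_rfl hε1
  have hM₀ : ∀ ψ : AddChar (Additive (ClassGroup (𝓞 K))) ℂ,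
      (famMult K ψ 0 : ℝ) * (L + ε) ≤ 1152 * Real.exp (L / 4) :=
    fun ψ ↦ famMult_zero_term_le hK ψ (by linarith) hε0.le hε1 hQexp
  have hJ0 : ‖dzEFRemainder K (tzTest L ε) 0‖ ≤ CJ := by
    have hJ := leftLine_term_le_one hAl0 hAl hM K hK hL0 hε0 hεL hε1 hν64 hεexp hQexp
    rw [hKn] at hJ; rw [hCJ]; exact hJ
  have hJ : ∀ ψ : AddChar (Additive (ClassGroup (𝓞 K))) ℂ, ψ ≠ 0 →
      ‖cgEFRemainder (toMulHom ψ).toHomUnits (tzTest L ε) 0‖ ≤ CJ := by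
    intro ψ hψ
    have hJ := leftLine_term_le hAl0 hAl hM K hK (toHomUnits_ne_one hψ) hL0 hε0 hεL hε1 hν64 hεexp hQexp
    rw [hKn] at hJ; rw [hCJ]; exact hJ
  have hest := norm_classNumber_mul_smoothedPsiClass_sub_le hx1 hε0 hεL Cl Exc hExc hExc' hBf hM₀ hJ0 hJ
  have hjunk : A₀ * x ^ (1 - ν) + (NumberField.classNumber K : ℝ) * (1152 * Real.exp (L / 4) + CJ) ≤
      AJ * x ^ (1 - ν) := junk_le_rpow hCJ0 hQ12 hhQ hν0 hν64 hx haC32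
  refine hest.trans ?_
  have e : A₀ * x * (Real.exp (-(cZ * Real.log x / (4 * a * Real.log (ThornerZaman.condQn K)))) +
      Real.exp (-Real.sqrt (cZ * Real.log x / 4))) + A₀ * x ^ (1 - ν) +
      (NumberField.classNumber K : ℝ) * (1152 * Real.exp (L / 4) + CJ) =
      x * (A₀ * (Real.exp (-(cZ * L / (4 * a * Real.log Q))) + Real.exp (-Real.sqrt (cZ * L / 4)))) +
      (A₀ * x ^ (1 - ν) + (NumberField.classNumber K : ℝ) * (1152 * Real.exp (L / 4) + CJ)) := by
    rw [hQ, hL]; ring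
  rw [e]
  linarith

end Summit.QuantumAdvantage.QuantumAdvantage.Theorems.DegreeOnePrimesEscape

end
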